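import Mathlib
/-!
# P6D4PairDefs — the order `ℤ[c]` (`c⁴ + 6c² + 7 = 0`), the pieces `B_{t·μ(ν)}` of the four explicit Cor-1.5 objects on `A*³`,
and the two certificates deciding whether the ideal `(δ₂, δ₃)` of a pair is the whole ring (p6 g11; page proofs/P6-D4PairComponents-v1.md)

THE MODEL (P3-D4TransferNegative-v1.1 §0, Lemma 3.2′ (a); the m-table page §0): `A* = ℂ²/Φ*(ℤ[c])` with `c⁴ + 6c² + 7 = 0`
(`a = −3 − c²`, `a² = 2`), `X = A*³`; a graph piece `B_μ = {x = μ₂y + μ₃z}` with `μ = t·μ(ν) ∈ ℤ[c]²`, `μ(ν) = (7y, x)` for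
`ν = x + y·b` a sum of distinct elements of the basis `1, a, b, ab, c, ac, bc, abc` of `F` over `ℚ` (indices `0 … 7`), `t ∈ {±1, ±2}`;
`B_0 = {0} × B₀` is `t = 0`.  For two distinct pieces with `δ = μ − μ′` the number of connected components of `B ∩ B′` is
`m = [ℤ[c] : (δ₂, δ₃)]`, the index of the ideal `(δ₂, δ₃) = ℤ-span{δ₂cⁱ, δ₃cⁱ : i = 0 … 3}` in `ℤ[c] = ℤ-span{cⁱ}` — so `m = 1`
iff `1 ∈ ℤ-span{δ₂cⁱ, δ₃cⁱ}` (`SpanOne`).  Elements of `ℤ[c]` are coefficient vectors `⟨x₀, x₁, x₂, x₃⟩ = x₀ + x₁c + x₂c² + x₃c³`.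

THE CERTIFICATES.  `m = 1`: integers `n₀ … n₇` with `Σ nᵢ gᵢ = 1` (`WholeCert`; `wholeOK` checks it, `wholeOK_sound` gives `SpanOne`).
`m ≥ 2`: a prime-or-not integer `p ≥ 2` and `w ∈ ℤ⁴` with `w·1 ≢ 0` and `w·gᵢ ≡ 0 (mod p)` for all eight generators (`ProperCert`;
`properOK` checks it, `properOK_sound` gives `¬ SpanOne`: a ℤ-linear functional vanishing mod `p` on the span and not on `1`).
Both checks are Bool-valued on explicit data and are decided by the kernel in the data files; the soundness lemmas below are proved
once, for all data.  Supporting, cited beside the page, never frozen; no import of the cell's modules.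
-/

namespace HodgeRepro0.P6D4Pairs

/-- An element `x₀ + x₁c + x₂c² + x₃c³` of `ℤ[c]`, `c⁴ + 6c² + 7 = 0`. -/
structure Zc where
  /-- the coefficient of `1` -/
  x0 : ℤ
  /-- the coefficient of `c` -/
  x1 : ℤ
  /-- the coefficient of `c²` -/
  x2 : ℤ
  /-- the coefficient of `c³` -/
  x3 : ℤ
  deriving DecidableEq, Repr

/-- `0 ∈ ℤ[c]`. -/
def zero : Zc := ⟨0, 0, 0, 0⟩
/-- `1 ∈ ℤ[c]`. -/
def one : Zc := ⟨1, 0, 0, 0⟩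
/-- `c`. -/
def cc : Zc := ⟨0, 1, 0, 0⟩
/-- `a = −3 − c²`. -/
def aa : Zc := ⟨-3, 0, -1, 0⟩
/-- Addition in `ℤ[c]`. -/
def add (x y : Zc) : Zc := ⟨x.x0 + y.x0, x.x1 + y.x1, x.x2 + y.x2, x.x3 + y.x3⟩
/-- Subtraction in `ℤ[c]`. -/
def sub (x y : Zc) : Zc := ⟨x.x0 - y.x0, x.x1 - y.x1, x.x2 - y.x2, x.x3 - y.x3⟩
/-- The `ℤ`-scalar action. -/
def smul (k : ℤ) (x : Zc) : Zc := ⟨k * x.x0, k * x.x1, k * x.x2, k * x.x3⟩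
/-- Multiplication in `ℤ[c]`, reducing with `c⁴ = −6c² − 7`, `c⁵ = −6c³ − 7c`, `c⁶ = 29c² + 42`. -/
def mul (x y : Zc) : Zc :=
  let r0 := x.x0 * y.x0
  let r1 := x.x0 * y.x1 + x.x1 * y.x0
  let r2 := x.x0 * y.x2 + x.x1 * y.x1 + x.x2 * y.x0
  let r3 := x.x0 * y.x3 + x.x1 * y.x2 + x.x2 * y.x1 + x.x3 * y.x0
  let r4 := x.x1 * y.x3 + x.x2 * y.x2 + x.x3 * y.x1
  let r5 := x.x2 * y.x3 + x.x3 * y.x2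
  let r6 := x.x3 * y.x3
  ⟨r0 - 7 * r4 + 42 * r6, r1 - 7 * r5, r2 - 6 * r4 + 29 * r6, r3 - 6 * r5⟩
/-- `a·c`. -/
def ac : Zc := mul aa cc
/-- The pairing `w·g = Σ wᵢgᵢ` of coefficient vectors (a `ℤ`-linear functional on `ℤ[c]` for fixed `w`). -/
def dot (w g : Zc) : ℤ := w.x0 * g.x0 + w.x1 * g.x1 + w.x2 * g.x2 + w.x3 * g.x3

/-- The `x`-parts (no `b`) of the basis `1, a, b, ab, c, ac, bc, abc` of `F = K*(b)` over `ℚ`, `ν = x + y·b`. -/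
def basisX : List Zc := [one, aa, zero, zero, cc, ac, zero, zero]
/-- The `y`-parts (the `b`-coefficients) of the same basis. -/
def basisY : List Zc := [zero, zero, one, aa, zero, zero, cc, ac]

/-- A piece `B_{t·μ(ν)}` (`t ≠ 0`) or `B_0` (`t = 0`): `ν` as the list of basis indices it sums, `t`, and its multiplicity `n_B` in the object. -/
structure Piece where
  /-- the basis indices of `ν` -/
  nu : List ℕ
  /-- the scale `t ∈ {0, ±1, ±2}` -/
  t : ℤ
  /-- the multiplicity `n_B` (the local page §1.5) -/
  n : ℤ
  deriving DecidableEq, Repr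

/-- `x(ν) = Σ` of the `x`-parts. -/
def nuX (nu : List ℕ) : Zc := nu.foldl (fun acc i => add acc (basisX.getD i zero)) zero
/-- `y(ν) = Σ` of the `y`-parts. -/
def nuY (nu : List ℕ) : Zc := nu.foldl (fun acc i => add acc (basisY.getD i zero)) zero
/-- `μ₂ = 7t·y(ν)`. -/
def mu2 (P : Piece) : Zc := smul (7 * P.t) (nuY P.nu)
/-- `μ₃ = t·x(ν)`. -/
def mu3 (P : Piece) : Zc := smul P.t (nuX P.nu)
/-- `δ = μ(P) − μ(Q)`. -/
def delta (P Q : Piece) : Zc × Zc := (sub (mu2 P) (mu2 Q), sub (mu3 P) (mu3 Q))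
/-- The eight `ℤ`-generators `δ₂cⁱ, δ₃cⁱ` (`i = 0 … 3`) of the ideal `(δ₂, δ₃)`. -/
def gens (d : Zc × Zc) : List Zc :=
  [d.1, mul d.1 cc, mul d.1 (mul cc cc), mul d.1 (mul cc (mul cc cc)),
   d.2, mul d.2 cc, mul d.2 (mul cc cc), mul d.2 (mul cc (mul cc cc))]
/-- `Σ nᵢ gᵢ` (the shorter list decides the length). -/
def combo : List ℤ → List Zc → Zc
  | k :: ks, g :: gs => add (smul k g) (combo ks gs)
  | _, _ => zero
/-- `1 ∈ ℤ-span(gens d)`: the ideal `(δ₂, δ₃)` is all of `ℤ[c]`, i.e. `m = 1`. -/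
def SpanOne (d : Zc × Zc) : Prop := ∃ n : List ℤ, combo n (gens d) = one

/-- A positive graph piece (copies of `I_B[1]` in `E^{id}_ω`; the `B` of Theorem 3 / Corollary 8). -/
def isPosGraph (P : Piece) : Bool := P.t != 0 && P.n > 0
/-- A live negative piece (`|n_{B′}| ≥ 3`: the shifted structure-sheaf neighbour with `n ≥ 3` copies of Corollary 8 (iv)). -/
def isLive (P : Piece) : Bool := P.n ≤ -3

/-- A certificate of `m = 1` for the pair `(i, j)`: `Σ nₖ gₖ = 1`. -/
structure WholeCert where
  /-- index of the positive graph piece -/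
  i : ℕ
  /-- index of the live negative piece -/
  j : ℕ
  /-- the eight integer coefficients -/
  n : List ℤ
  deriving Repr
/-- A certificate of `m ≥ 2` for the pair `(i, j)`: `p ≥ 2`, `w·1 ≢ 0`, `w·gₖ ≡ 0 (mod p)`. -/
structure ProperCert where
  /-- index of the positive graph piece -/
  i : ℕ
  /-- index of the live negative piece -/
  j : ℕ
  /-- the modulus -/
  p : ℕ
  /-- the functional -/
  w : Zc
  deriving Repr

/-- The check of a `WholeCert` against the piece list. -/
def wholeOK (ps : List Piece) (cert : WholeCert) : Bool :=
  match ps[cert.i]?, ps[cert.j]? with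
  | some P, some Q => isPosGraph P && isLive Q && decide (combo cert.n (gens (delta P Q)) = one)
  | _, _ => false
/-- The check of a `ProperCert` against the piece list. -/
def properOK (ps : List Piece) (cert : ProperCert) : Bool :=
  match ps[cert.i]?, ps[cert.j]? with
  | some P, some Q => isPosGraph P && isLive Q && decide (2 ≤ cert.p) && decide (dot cert.w one % (cert.p : ℤ) ≠ 0) &&
      (gens (delta P Q)).all (fun g => decide (dot cert.w g % (cert.p : ℤ) = 0))
  | _, _ => false
/-- All live pairs `(i, j)` of the piece list. -/
def livePairs (ps : List Piece) : List (ℕ × ℕ) :=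
  (List.range ps.length).flatMap (fun i => (List.range ps.length).filterMap (fun j =>
    match ps[i]?, ps[j]? with
    | some P, some Q => if isPosGraph P && isLive Q then some (i, j) else none
    | _, _ => none))
/-- The keys `(i, j)` of a certificate list. -/
def oneKeys (ones : List WholeCert) : List (ℕ × ℕ) := ones.map (fun c => (c.i, c.j))
/-- The keys `(i, j)` of a certificate list. -/
def propKeys (props : List ProperCert) : List (ℕ × ℕ) := props.map (fun c => (c.i, c.j))
/-- Every live pair is a key of exactly one of the two certificate lists. -/
def coverOK (ps : List Piece) (ones : List WholeCert) (props : List ProperCert) : Bool :=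
  (livePairs ps).all (fun ij => (decide (ij ∈ oneKeys ones)) != (decide (ij ∈ propKeys props)))
/-- Every positive graph piece has a live neighbour with a `ProperCert` (`m ≥ 2`). -/
def headlineOK (ps : List Piece) (props : List ProperCert) : Bool :=
  (List.range ps.length).all (fun i => match ps[i]? with
    | some P => !(isPosGraph P) || props.any (fun c => c.i == i)
    | none => true)

/-! ## Soundness of the two certificates -/

/-- `dot` is additive in its second argument. -/
theorem dot_add (w x y : Zc) : dot w (add x y) = dot w x + dot w y := by
  simp only [dot, add]; ring
/-- `dot` is `ℤ`-linear in its second argument. -/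
theorem dot_smul (w : Zc) (k : ℤ) (x : Zc) : dot w (smul k x) = k * dot w x := by
  simp only [dot, smul]; ring
/-- `dot w 0 = 0`. -/
theorem dot_zero (w : Zc) : dot w zero = 0 := by simp [dot, zero]

/-- A functional vanishing mod `p` on every generator vanishes mod `p` on every combination. -/
theorem dvd_dot_combo (w : Zc) (p : ℤ) : ∀ (gs : List Zc) (n : List ℤ),
    (∀ g ∈ gs, p ∣ dot w g) → p ∣ dot w (combo n gs)
  | [], n, _ => by cases n <;> simp [combo, dot_zero]
  | g :: gs, [], _ => by simp [combo, dot_zero]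
  | g :: gs, k :: ks, h => by
      simp only [combo, dot_add, dot_smul]
      exact dvd_add (dvd_mul_of_dvd_right (h g (List.mem_cons_self ..)) k)
        (dvd_dot_combo w p gs ks (fun g' hg' => h g' (List.mem_cons_of_mem _ hg')))

/-- Soundness of `properOK`: the pair's ideal is proper (`m ≥ 2`). -/
theorem properOK_sound (ps : List Piece) (cert : ProperCert) (h : properOK ps cert = true) :
    ∀ P Q, ps[cert.i]? = some P → ps[cert.j]? = some Q → ¬ SpanOne (delta P Q) := by
  intro P Q hP hQ ⟨n, hn⟩
  simp only [properOK, hP, hQ, Bool.and_eq_true, decide_eq_true_eq, List.all_eq_true] at h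
  obtain ⟨⟨⟨⟨-, -⟩, -⟩, hone⟩, hall⟩ := h
  have hdvd : (cert.p : ℤ) ∣ dot cert.w (combo n (gens (delta P Q))) :=
    dvd_dot_combo cert.w (cert.p : ℤ) _ n (fun g hg => Int.dvd_of_emod_eq_zero (hall g hg))
  rw [hn] at hdvd
  exact hone (Int.emod_eq_zero_of_dvd hdvd)

/-- Soundness of `wholeOK`: the pair's ideal is the whole ring (`m = 1`). -/
theorem wholeOK_sound (ps : List Piece) (cert : WholeCert) (h : wholeOK ps cert = true) :
    ∀ P Q, ps[cert.i]? = some P → ps[cert.j]? = some Q → SpanOne (delta P Q) := by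
  intro P Q hP hQ
  simp only [wholeOK, hP, hQ, Bool.and_eq_true, decide_eq_true_eq] at h
  exact ⟨cert.n, h.2⟩


/-- A verified `ProperCert` names two pieces of the list, a positive graph piece and a live one. -/
theorem properOK_some (ps : List Piece) (cert : ProperCert) (h : properOK ps cert = true) :
    ∃ P Q, ps[cert.i]? = some P ∧ ps[cert.j]? = some Q ∧ isPosGraph P = true ∧ isLive Q = true := by
  unfold properOK at h
  split at h
  · rename_i P Q hP hQ
    simp only [Bool.and_eq_true] at h
    exact ⟨P, Q, hP, hQ, h.1.1.1.1, h.1.1.1.2⟩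
  · exact absurd h Bool.false_ne_true

/-- A live pair is listed in `livePairs`. -/
theorem mem_livePairs (ps : List Piece) (i j : ℕ) (P Q : Piece) (hP : ps[i]? = some P) (hQ : ps[j]? = some Q)
    (hpos : isPosGraph P = true) (hlive : isLive Q = true) : (i, j) ∈ livePairs ps := by
  have hi : i < ps.length := (List.getElem?_eq_some_iff.mp hP).1
  have hj : j < ps.length := (List.getElem?_eq_some_iff.mp hQ).1
  unfold livePairs
  rw [List.mem_flatMap]
  refine ⟨i, List.mem_range.mpr hi, ?_⟩
  rw [List.mem_filterMap]
  refine ⟨j, List.mem_range.mpr hj, ?_⟩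
  simp [hP, hQ, hpos, hlive]

/-- THE READING, for all data at once: if every `WholeCert` and every `ProperCert` verifies and the two lists cover the live pairs
exactly once, then for every live pair `(i, j)` the ideal `(δ₂, δ₃)` is the whole ring (`m = 1`) iff `(i, j)` is a `WholeCert` key. -/
theorem reading_of_certs (ps : List Piece) (ones : List WholeCert) (props : List ProperCert)
    (ho : ones.all (wholeOK ps) = true) (hp : props.all (properOK ps) = true) (hc : coverOK ps ones props = true) :
    ∀ (i j : ℕ) (P Q : Piece), ps[i]? = some P → ps[j]? = some Q → isPosGraph P = true → isLive Q = true →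
      (SpanOne (delta P Q) ↔ (i, j) ∈ oneKeys ones) := by
  intro i j P Q hP hQ hpos hlive
  have hmem := mem_livePairs ps i j P Q hP hQ hpos hlive
  have hx := List.all_eq_true.mp hc (i, j) hmem
  constructor
  · intro hs
    by_contra hno
    have hin : (i, j) ∈ propKeys props := by
      simpa [hno] using hx
    obtain ⟨c, hc', hcij⟩ := List.mem_map.mp hin
    have hcert := List.all_eq_true.mp hp c hc'
    have hci : c.i = i := (Prod.mk.injEq _ _ _ _).mp hcij |>.1
    have hcj : c.j = j := (Prod.mk.injEq _ _ _ _).mp hcij |>.2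
    exact properOK_sound ps c hcert P Q (hci ▸ hP) (hcj ▸ hQ) hs
  · intro hin
    obtain ⟨c, hc', hcij⟩ := List.mem_map.mp hin
    have hcert := List.all_eq_true.mp ho c hc'
    have hci : c.i = i := (Prod.mk.injEq _ _ _ _).mp hcij |>.1
    have hcj : c.j = j := (Prod.mk.injEq _ _ _ _).mp hcij |>.2
    exact wholeOK_sound ps c hcert P Q (hci ▸ hP) (hcj ▸ hQ)

/-- THE HEADLINE, for all data at once: if every `ProperCert` verifies and every positive graph piece has one, then every
positive graph piece has a live neighbour whose ideal is proper (`m ≥ 2`). -/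
theorem headline_of_certs (ps : List Piece) (props : List ProperCert)
    (hp : props.all (properOK ps) = true) (hh : headlineOK ps props = true) :
    ∀ (i : ℕ) (P : Piece), ps[i]? = some P → isPosGraph P = true →
      ∃ (j : ℕ) (Q : Piece), ps[j]? = some Q ∧ isLive Q = true ∧ ¬ SpanOne (delta P Q) := by
  intro i P hP hpos
  have hi : i < ps.length := (List.getElem?_eq_some_iff.mp hP).1
  have hx := List.all_eq_true.mp hh i (List.mem_range.mpr hi)
  simp only [hP, hpos, Bool.not_true, Bool.false_or, List.any_eq_true, beq_iff_eq] at hx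
  obtain ⟨c, hc', hci⟩ := hx
  have hcert := List.all_eq_true.mp hp c hc'
  obtain ⟨P', Q, hP', hQ, -, hlive⟩ := properOK_some ps c hcert
  have hPP : P' = P := by
    rw [hci] at hP'; rw [hP'] at hP; exact Option.some.inj hP
  subst hPP
  exact ⟨c.j, Q, hQ, hlive, properOK_sound ps c hcert P' Q hP' hQ⟩

end HodgeRepro0.P6D4Pairs
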